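import Summits.QuantumFields.YangMills.Theorems.UnitScaleTiltProp7ChartPiecesTwS
import Summits.QuantumFields.YangMills.Theorems.UnitScaleTiltProp7ChartDatumSplitS
import Summits.QuantumFields.YangMills.Theorems.UnitScaleTiltProp7ChartLandauSplitS
import HarnessLib

/-!
# Route `UnitScaleTilt`, crux K1 child «MinimiserStabilityRegPr» (stmt-QuantumFields-19200), skeleton v10, stub `stub_existenceMinimalOrbit` (EX), route (α) — **(CH-KNIT v2ˢ) THE
# MEMBER-LEVEL JUNCTIONS WITH THE (21)-LETTER GENERIC** (display place (d) of ★★OWNER ACK 34 (1): «`IsLandauPrintS` only when the twin exists» — it does, ✓`Prop7SPrint.IsLandauPrintS`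
# (`…SPrintDefsS` §4); knit ruler's consumer plan, bus 2026-08-28 ≈09:34Z: MINIMISER-side Landau rows → `IsLandauPrintS (c₀ L) (cB L)`, competitor binder keeps print's `IsLandauPrint`).
# (21) is PASS-THROUGH on the minimiser side (rows → split → CHART-112's (21) conjunct → C-min → growth row; never unfolded), so the three member-level junctions are re-typed
# ONCE for an ARBITRARY condition `Lan` on fine fields (closed under `+`, `ℂ•` where the split needs it); the knit instantiates `Lan := IsLandauPrintS … (c₀ L) (cB L) U₀`

Cell `ym3-torus`, width seat `ym-ust-19200-w2` (gen 3; EX KNIT RULER).  THEOREMS ONLY (0 `def`, 0 `sorry`).  Bookkeeping: nothing here closes the stub; `--supports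
stmt-QuantumFields-19200 --as helper`, count-neutral.  YM₃ on T³ is a ladder rung (R3), not the Clay problem; nothing here claims the stub, the crux, d = 4 or the mass gap.

WHAT IS PROVED (sorry-free, no definition; `Lan : (PBond (F.P K) 0 → M₂(ℂ)) → Prop` arbitrary): §1 ★ `landau_of_split`, §2 ★ `hXtw'_of_splitG`, §3 ★ `hXtw_of_split_etaG`, §4 ★★
`hChart_of_piecesTwG` — the generic twins of ✓`isLandauPrint_of_split` ∕ ✓`hXtw'_of_splitLS` ∕ ✓`hXtw_of_split_etaS` ∕ ✓`hChart_of_piecesTwS`, proofs token for token.  HONEST SCOPE: bookkeeping.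

References: T. Bałaban, CMP 102 (1985) 277–309 [Balaban1985Variational]; CMP 99 (1985) 389–434 [Balaban1985BackgroundPropagators]; CMP 99 (1985) 75–102 [Balaban1985RegularSpaces];
CMP 98 (1985) 17–51 [Balaban1985Averaging] (loci in the theorem docstrings).
-/

set_option autoImplicit false

noncomputable section

open scoped Matrix.Norms.L2Operator

namespace Summit.QuantumFields.YangMills.Theorems.Prop7ChartPiecesTwG

open NormedSpace
open Literature.MathematicalPhysics.QuantumFieldTheory.Balaban1983to89
open Literature.MathematicalPhysics.QuantumFieldTheory.Balaban1983to89.T3ContinuumYM3Torus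
open Literature.MathematicalPhysics.QuantumFieldTheory.Balaban1983to89.T3UnitLawDensityEML (ℰp)
open Literature.MathematicalPhysics.QuantumFieldTheory.Balaban1983to89.T3TiltDescent (descendTo)
open Literature.MathematicalPhysics.QuantumFieldTheory.Balaban1983to89.T3ConstrainedMinimiser (fibre)
open Literature.MathematicalPhysics.QuantumFieldTheory.Balaban1983to89.T3PrintedRegularMinimiser (RegPr)
open Literature.MathematicalPhysics.QuantumFieldTheory.Balaban1983to89.T3PrintedMinimiserExistence (regPr_mono)
open Literature.MathematicalPhysics.QuantumFieldTheory.Balaban1983to89.T3SectALandauChart (In19 emb15 CloseAvg eta eta_pos)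
open B9SectCLatticeCarrier (Bond)
open B10Eq27TorusAxialLog (unitsField toUField val_unitsField pull)
open B11Eq115Space (NegSize Space115 JetSup levWeight)
open B11Eq111FrakG (nabla115)
open B11Eq98CurrentSlot (Jcur)
open B11Prop3Model (Dfix)
open MatrixLog (mlog)
open Summit.QuantumFields.YangMills.Theorems.Prop7TPrint (nMax19 expHermField expHermField_apply coe_expHerm)
open Summit.QuantumFields.YangMills.Theorems.Prop7SectET3Transport (periodsT3 bgOfCfg bondEquiv levWeight_const_eq_one)
open Summit.QuantumFields.YangMills.Theorems.Prop7SymAvgTwSym (dbarTwS frameTwS QTwS CmapTwS Chart47T3twS)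
open Summit.QuantumFields.YangMills.Theorems.Prop7SymAvgTwSymEq137 (fibreClauseS_of_chart47twS)
open Summit.QuantumFields.YangMills.Theorems.Prop7ChartPiecesTw (norm_datum_sub_one_lt_of_closeAvg)
open Summit.QuantumFields.YangMills.Theorems.Prop7B8Prop7Div (regPr_emb15_of_in19)
open Summit.QuantumFields.YangMills.Theorems.Prop7PV3CDELogChart (in19_expHermField_of_nMax19_lt)
open Summit.QuantumFields.YangMills.Theorems.Prop7ChartDatumSplit (norm_jetRead_le jetRead_add mlog_datum_eq)
open Summit.QuantumFields.YangMills.Theorems.Prop7SPrint (AvgCondPrintS NormS basePt)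
open Summit.QuantumFields.YangMills.Theorems.Prop7ChartDatumSplitS (datum_of_split_etaS)

variable (F : T3Family) {n K : ℕ} (h : n ≤ K)

section Split

variable (F : T3Family) {n K : ℕ} (h : n ≤ K) [Fact (0 < (F.L : ℝ))] [Fact (0 < ((F.L : ℝ)⁻¹) ^ (K - n))]
  {V : GaugeField (F.P n) 0 (Matrix.specialUnitaryGroup (Fin 2) ℂ)} {U₀ : GaugeField (F.P K) 0 (Matrix.specialUnitaryGroup (Fin 2) ℂ)}
  {𝒢 : NegSize (F.L : ℝ) (((F.L : ℝ)⁻¹) ^ (K - n)) (fun _ : Bond 3 (periodsT3 F K) => K - n) 3 (Matrix (Fin 2) (Fin 2) ℂ) →L[ℂ]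
        Space115 (F.L : ℝ) (((F.L : ℝ)⁻¹) ^ (K - n)) (fun _ : Bond 3 (periodsT3 F K) => K - n) (fun _ : Bond 3 (periodsT3 F K) × Fin 3 => K - n)
          (nabla115 (((F.L : ℝ)⁻¹) ^ (K - n)) (bgOfCfg F K U₀))}
  {W : Space115 (F.L : ℝ) (((F.L : ℝ)⁻¹) ^ (K - n)) (fun _ : Bond 3 (periodsT3 F K) => K - n) (fun _ : Bond 3 (periodsT3 F K) × Fin 3 => K - n)
          (nabla115 (((F.L : ℝ)⁻¹) ^ (K - n)) (bgOfCfg F K U₀)) →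
        NegSize (F.L : ℝ) (((F.L : ℝ)⁻¹) ^ (K - n)) (fun _ : Bond 3 (periodsT3 F K) => K - n) 3 (Matrix (Fin 2) (Fin 2) ℂ)}
  {H₁ : (PBond (F.P n) 0 → Matrix (Fin 2) (Fin 2) ℂ) →L[ℂ]
        Space115 (F.L : ℝ) (((F.L : ℝ)⁻¹) ^ (K - n)) (fun _ : Bond 3 (periodsT3 F K) => K - n) (fun _ : Bond 3 (periodsT3 F K) × Fin 3 => K - n)
          (nabla115 (((F.L : ℝ)⁻¹) ^ (K - n)) (bgOfCfg F K U₀))}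
  {H : (PBond (F.P n) 0 → Matrix (Fin 2) (Fin 2) ℂ) →ₗ[ℂ] (PBond (F.P K) 0 → Matrix (Fin 2) (Fin 2) ℂ)}

/-! ## §1 (21) for the chart exponent from three rows, for ANY ℂ-linear condition `Lan` -/

/-- ★ **(21) FOR THE CHART EXPONENT FROM (102)-L, (129)-L, (45), (21)-LETTER GENERIC** (generic ✓`isLandauPrint_of_split`): for any `Lan` closed under `+` and `ℂ•`, a solution `A₁`
of (111), `A′ := iη·ι(A₁ + H₁ Bsym)`, `iX = A′ − H·D`: the three rows give `Lan X` (print p. 289 (76)). [cite: Balaban1985Variational, (21) p.281, (45)–(47) p.285, (76) p.289, (102)–(103) p.293, (111)–(112) p.294; Balaban1985BackgroundPropagators, (3.124) p.420] -/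
theorem landau_of_split (Lan : (PBond (F.P K) 0 → Matrix (Fin 2) (Fin 2) ℂ) → Prop)
    (hadd : ∀ X Y, Lan X → Lan Y → Lan (X + Y)) (hsmul : ∀ (a : ℂ) X, Lan X → Lan (a • X))
    {D : PBond (F.P n) 0 → Matrix (Fin 2) (Fin 2) ℂ}
    (h102L : ∀ f : NegSize (F.L : ℝ) (((F.L : ℝ)⁻¹) ^ (K - n)) (fun _ : Bond 3 (periodsT3 F K) => K - n) 3 (Matrix (Fin 2) (Fin 2) ℂ),
      Lan (fun b : PBond (F.P K) 0 => JetSup.equiv _ _ _ (𝒢 f) (bondEquiv F K b)))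
    (h129L : ∀ B : PBond (F.P n) 0 → Matrix (Fin 2) (Fin 2) ℂ,
      Lan (fun b : PBond (F.P K) 0 => JetSup.equiv _ _ _ (H₁ B) (bondEquiv F K b)))
    (h45 : ∀ Y : PBond (F.P n) 0 → Matrix (Fin 2) (Fin 2) ℂ, Lan (H Y))
    (A₁ : Space115 (F.L : ℝ) (((F.L : ℝ)⁻¹) ^ (K - n)) (fun _ : Bond 3 (periodsT3 F K) => K - n) (fun _ : Bond 3 (periodsT3 F K) × Fin 3 => K - n)
      (nabla115 (((F.L : ℝ)⁻¹) ^ (K - n)) (bgOfCfg F K U₀)))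
    (h111 : A₁ + 𝒢 (Jcur (bgOfCfg F K U₀)) + 𝒢 (W (A₁ + H₁ (fun c : PBond (F.P n) 0 =>
        (-Complex.I) • mlog (((V c : Matrix.specialUnitaryGroup (Fin 2) ℂ) : Matrix (Fin 2) (Fin 2) ℂ)
          * star ((descendTo F ℰp n K h U₀ c : Matrix.specialUnitaryGroup (Fin 2) ℂ) : Matrix (Fin 2) (Fin 2) ℂ))))) = 0)
    {X : PBond (F.P K) 0 → Matrix (Fin 2) (Fin 2) ℂ}
    (hAX : (((eta F n K : ℝ) : ℂ) * Complex.I) • ((fun b : PBond (F.P K) 0 => JetSup.equiv _ _ _ A₁ (bondEquiv F K b))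
              + (fun b : PBond (F.P K) 0 => JetSup.equiv _ _ _ (H₁ (fun c : PBond (F.P n) 0 =>
                  (-Complex.I) • mlog (((V c : Matrix.specialUnitaryGroup (Fin 2) ℂ) : Matrix (Fin 2) (Fin 2) ℂ)
                    * star ((descendTo F ℰp n K h U₀ c : Matrix.specialUnitaryGroup (Fin 2) ℂ) : Matrix (Fin 2) (Fin 2) ℂ)))) (bondEquiv F K b)))
            - H D = fun b => Complex.I • X b) :
    Lan X := by
  set B : PBond (F.P n) 0 → Matrix (Fin 2) (Fin 2) ℂ := fun c =>
    (-Complex.I) • mlog (((V c : Matrix.specialUnitaryGroup (Fin 2) ℂ) : Matrix (Fin 2) (Fin 2) ℂ)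
      * star ((descendTo F ℰp n K h U₀ c : Matrix.specialUnitaryGroup (Fin 2) ℂ) : Matrix (Fin 2) (Fin 2) ℂ)) with hB
  -- `A₁` is in the range of `𝔊` ((111)), so (102) applies to it
  have hA₁ : A₁ = 𝒢 (-(Jcur (bgOfCfg F K U₀) + W (A₁ + H₁ B))) := by
    rw [map_neg, map_add]
    exact eq_neg_of_add_eq_zero_left (by rw [← add_assoc]; exact h111)
  have hL1 : Lan (fun b : PBond (F.P K) 0 => JetSup.equiv _ _ _ A₁ (bondEquiv F K b)) := by
    rw [hA₁]; exact h102L _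
  -- the chart parameter `A′` and the chart image `A′ − H D` satisfy (21)
  have hA' : Lan ((((eta F n K : ℝ) : ℂ) * Complex.I) • ((fun b : PBond (F.P K) 0 => JetSup.equiv _ _ _ A₁ (bondEquiv F K b))
      + (fun b : PBond (F.P K) 0 => JetSup.equiv _ _ _ (H₁ B) (bondEquiv F K b)))) :=
    hsmul _ _ (hadd _ _ hL1 (h129L B))
  have hsub : ∀ Y Z, Lan Y → Lan Z → Lan (Y - Z) := fun Y Z hY hZ => by
    rw [sub_eq_add_neg, ← neg_one_smul ℂ Z]; exact hadd _ _ hY (hsmul _ _ hZ)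
  have himg := hsub _ _ hA' (h45 D)
  rw [hAX] at himg
  -- `X = (−i)·(iX)`
  have hX : X = (-Complex.I) • fun b => Complex.I • X b := by
    funext b
    rw [Pi.smul_apply, smul_smul, show -Complex.I * Complex.I = 1 by rw [neg_mul, Complex.I_mul_I, neg_neg], one_smul]
  rw [hX]
  exact hsmul _ _ himg

/-! ## §2 The knit's (CH5EL-twˢ)′ display from the thinner display without (21), (21)-letter generic -/

/-- ★ **THE (CH5EL-twˢ)′ DISPLAY FROM THE THINNER DISPLAY `hXtw″` AND THE ROWS (102)-L ∕ (129)-L ∕ (45), (21)-LETTER GENERIC** (generic ✓`hXtw'_of_splitLS`: the (21)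
conjunct of `hXtw′` reads `Lan X`, supplied by `landau_of_split`). [cite: Balaban1985Variational, (21) p.281, (76) p.289, (102)–(103) p.293, (112) p.294, Prop. 5 p.294] -/
theorem hXtw'_of_splitG (Lan : (PBond (F.P K) 0 → Matrix (Fin 2) (Fin 2) ℂ) → Prop)
    (hadd : ∀ X Y, Lan X → Lan Y → Lan (X + Y)) (hsmul : ∀ (a : ℂ) X, Lan X → Lan (a • X)) {ε₄ M C₂ : ℝ}
    (h102L : ∀ f : NegSize (F.L : ℝ) (((F.L : ℝ)⁻¹) ^ (K - n)) (fun _ : Bond 3 (periodsT3 F K) => K - n) 3 (Matrix (Fin 2) (Fin 2) ℂ),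
      Lan (fun b : PBond (F.P K) 0 => JetSup.equiv _ _ _ (𝒢 f) (bondEquiv F K b)))
    (h129L : ∀ B : PBond (F.P n) 0 → Matrix (Fin 2) (Fin 2) ℂ,
      Lan (fun b : PBond (F.P K) 0 => JetSup.equiv _ _ _ (H₁ B) (bondEquiv F K b)))
    (h45 : ∀ Y : PBond (F.P n) 0 → Matrix (Fin 2) (Fin 2) ℂ, Lan (H Y))
    -- the thinner display: (112) ∘ Prop. 5 ∘ (123)–(140) ∘ E–L, WITHOUT (21)
    (hXtw'' : ∀ A₁ : Space115 (F.L : ℝ) (((F.L : ℝ)⁻¹) ^ (K - n)) (fun _ : Bond 3 (periodsT3 F K) => K - n) (fun _ : Bond 3 (periodsT3 F K) × Fin 3 => K - n)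
            (nabla115 (((F.L : ℝ)⁻¹) ^ (K - n)) (bgOfCfg F K U₀)),
      ‖A₁‖ < ε₄ → A₁ + 𝒢 (Jcur (bgOfCfg F K U₀)) + 𝒢 (W (A₁ + H₁ (fun c : PBond (F.P n) 0 =>
        (-Complex.I) • mlog (((V c : Matrix.specialUnitaryGroup (Fin 2) ℂ) : Matrix (Fin 2) (Fin 2) ℂ)
          * star ((descendTo F ℰp n K h U₀ c : Matrix.specialUnitaryGroup (Fin 2) ℂ) : Matrix (Fin 2) (Fin 2) ℂ))))) = 0 →
        ∃ X : PBond (F.P K) 0 → Matrix (Fin 2) (Fin 2) ℂ,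
          (∀ b : PBond (F.P K) 0, (X b).IsHermitian ∧ Matrix.trace (X b) = 0) ∧
          (((eta F n K : ℝ) : ℂ) * Complex.I) • ((fun b : PBond (F.P K) 0 => JetSup.equiv _ _ _ A₁ (bondEquiv F K b))
              + (fun b : PBond (F.P K) 0 => JetSup.equiv _ _ _ (H₁ (fun c : PBond (F.P n) 0 =>
                  (-Complex.I) • mlog (((V c : Matrix.specialUnitaryGroup (Fin 2) ℂ) : Matrix (Fin 2) (Fin 2) ℂ)
                    * star ((descendTo F ℰp n K h U₀ c : Matrix.specialUnitaryGroup (Fin 2) ℂ) : Matrix (Fin 2) (Fin 2) ℂ)))) (bondEquiv F K b)))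
            - H (Dfix (CmapTwS F n K h U₀) H C₂
              ((((eta F n K : ℝ) : ℂ) * Complex.I) • ((fun b : PBond (F.P K) 0 => JetSup.equiv _ _ _ A₁ (bondEquiv F K b))
              + (fun b : PBond (F.P K) 0 => JetSup.equiv _ _ _ (H₁ (fun c : PBond (F.P n) 0 =>
                  (-Complex.I) • mlog (((V c : Matrix.specialUnitaryGroup (Fin 2) ℂ) : Matrix (Fin 2) (Fin 2) ℂ)
                    * star ((descendTo F ℰp n K h U₀ c : Matrix.specialUnitaryGroup (Fin 2) ℂ) : Matrix (Fin 2) (Fin 2) ℂ)))) (bondEquiv F K b)))))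
            = (fun b => Complex.I • X b) ∧
          nMax19 F n K U₀ X ≤ M * (‖A₁‖ + ‖H₁ (fun c : PBond (F.P n) 0 =>
            (-Complex.I) • mlog (((V c : Matrix.specialUnitaryGroup (Fin 2) ℂ) : Matrix (Fin 2) (Fin 2) ℂ)
              * star ((descendTo F ℰp n K h U₀ c : Matrix.specialUnitaryGroup (Fin 2) ℂ) : Matrix (Fin 2) (Fin 2) ℂ)))‖) ∧
          (∀ u : GaugeTransf (F.P K) 0 (Matrix.specialUnitaryGroup (Fin 2) ℂ), NormS F n K h U₀ X (expHermField X) u →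
            GaugeField.gaugeAct u (emb15 U₀ (expHermField X)) ∈ fibre F ℰp n K h V →
            ∀ γ : ℝ → GaugeField (F.P K) 0 (Matrix.specialUnitaryGroup (Fin 2) ℂ), γ 0 = GaugeField.gaugeAct u (emb15 U₀ (expHermField X)) →
              (∀ t, γ t ∈ fibre F ℰp n K h V) →
              (∀ b, DifferentiableAt ℝ (fun t => ((γ t b : Matrix.specialUnitaryGroup (Fin 2) ℂ) : Matrix (Fin 2) (Fin 2) ℂ)) 0) →
                deriv (fun t => wilsonAction4 (γ t)) 0 = 0)) :
    ∀ A₁ : Space115 (F.L : ℝ) (((F.L : ℝ)⁻¹) ^ (K - n)) (fun _ : Bond 3 (periodsT3 F K) => K - n) (fun _ : Bond 3 (periodsT3 F K) × Fin 3 => K - n)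
          (nabla115 (((F.L : ℝ)⁻¹) ^ (K - n)) (bgOfCfg F K U₀)),
      ‖A₁‖ < ε₄ → A₁ + 𝒢 (Jcur (bgOfCfg F K U₀)) + 𝒢 (W (A₁ + H₁ (fun c : PBond (F.P n) 0 =>
        (-Complex.I) • mlog (((V c : Matrix.specialUnitaryGroup (Fin 2) ℂ) : Matrix (Fin 2) (Fin 2) ℂ)
          * star ((descendTo F ℰp n K h U₀ c : Matrix.specialUnitaryGroup (Fin 2) ℂ) : Matrix (Fin 2) (Fin 2) ℂ))))) = 0 →
        ∃ X : PBond (F.P K) 0 → Matrix (Fin 2) (Fin 2) ℂ,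
          (∀ b : PBond (F.P K) 0, (X b).IsHermitian ∧ Matrix.trace (X b) = 0) ∧
          (((eta F n K : ℝ) : ℂ) * Complex.I) • ((fun b : PBond (F.P K) 0 => JetSup.equiv _ _ _ A₁ (bondEquiv F K b))
              + (fun b : PBond (F.P K) 0 => JetSup.equiv _ _ _ (H₁ (fun c : PBond (F.P n) 0 =>
                  (-Complex.I) • mlog (((V c : Matrix.specialUnitaryGroup (Fin 2) ℂ) : Matrix (Fin 2) (Fin 2) ℂ)
                    * star ((descendTo F ℰp n K h U₀ c : Matrix.specialUnitaryGroup (Fin 2) ℂ) : Matrix (Fin 2) (Fin 2) ℂ)))) (bondEquiv F K b)))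
            - H (Dfix (CmapTwS F n K h U₀) H C₂
              ((((eta F n K : ℝ) : ℂ) * Complex.I) • ((fun b : PBond (F.P K) 0 => JetSup.equiv _ _ _ A₁ (bondEquiv F K b))
              + (fun b : PBond (F.P K) 0 => JetSup.equiv _ _ _ (H₁ (fun c : PBond (F.P n) 0 =>
                  (-Complex.I) • mlog (((V c : Matrix.specialUnitaryGroup (Fin 2) ℂ) : Matrix (Fin 2) (Fin 2) ℂ)
                    * star ((descendTo F ℰp n K h U₀ c : Matrix.specialUnitaryGroup (Fin 2) ℂ) : Matrix (Fin 2) (Fin 2) ℂ)))) (bondEquiv F K b)))))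
            = (fun b => Complex.I • X b) ∧
          nMax19 F n K U₀ X ≤ M * (‖A₁‖ + ‖H₁ (fun c : PBond (F.P n) 0 =>
            (-Complex.I) • mlog (((V c : Matrix.specialUnitaryGroup (Fin 2) ℂ) : Matrix (Fin 2) (Fin 2) ℂ)
              * star ((descendTo F ℰp n K h U₀ c : Matrix.specialUnitaryGroup (Fin 2) ℂ) : Matrix (Fin 2) (Fin 2) ℂ)))‖) ∧
          Lan X ∧
          (∀ u : GaugeTransf (F.P K) 0 (Matrix.specialUnitaryGroup (Fin 2) ℂ), NormS F n K h U₀ X (expHermField X) u →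
            GaugeField.gaugeAct u (emb15 U₀ (expHermField X)) ∈ fibre F ℰp n K h V →
            ∀ γ : ℝ → GaugeField (F.P K) 0 (Matrix.specialUnitaryGroup (Fin 2) ℂ), γ 0 = GaugeField.gaugeAct u (emb15 U₀ (expHermField X)) →
              (∀ t, γ t ∈ fibre F ℰp n K h V) →
              (∀ b, DifferentiableAt ℝ (fun t => ((γ t b : Matrix.specialUnitaryGroup (Fin 2) ℂ) : Matrix (Fin 2) (Fin 2) ℂ)) 0) →
                deriv (fun t => wilsonAction4 (γ t)) 0 = 0) := by
  intro A₁ hA₁ h111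
  obtain ⟨X, hX, hAX, hsize, hEL⟩ := hXtw'' A₁ hA₁ h111
  exact ⟨X, hX, hAX, hsize, landau_of_split F h Lan hadd hsmul h102L h129L h45 A₁ h111 hAX, hEL⟩

end Split

/-! ## §3 The datum row at scale, (21)-letter generic (datum equation = ✓`Prop7ChartDatumSplitS.datum_of_split_etaS`)

Print measures (115)-fields `A₁`, `H₁B` in the `A`-scale of `U = e^{iηA}` and the chart parameter of the twisted chart in the exponent scale `ηA` ([Balaban1985Variational] (19) p.281,
(112) p.294 «U₁ = exp iη(A′₁ − HD(A′₁))»; [Balaban1985BackgroundPropagators] (3.14) «(1∕η_j)Q_j(U, ηA) = Q_j(U)A + C_j(U, A)», `η_k = Lᵏη = 1` at the T³ member): the torus chart parameter of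
print's `A′ = A₁ + H₁B` is `iη·ι(A₁ + H₁B)`, and print's NORMALISED averaging operator is `Q(U₀) = η·(QTwS U₀ ∘ ι)`, so «`QH₁B = B`» reads `QTw U₀ (ι(H₁B)) = η⁻¹B`.  §3–§4 above are the
`η = 1` normalisation of the same algebra (valid, but not the rows a supplier of print's `H₁(U₀)` meets when `K > n`); THIS section is the one the knit consumes. -/

section SplitEtaG

open Literature.MathematicalPhysics.QuantumFieldTheory.Balaban1983to89.T3SectALandauChart (eta eta_pos)

variable [Fact (0 < (F.L : ℝ))] [Fact (0 < ((F.L : ℝ)⁻¹) ^ (K - n))]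
  {V : GaugeField (F.P n) 0 (Matrix.specialUnitaryGroup (Fin 2) ℂ)} {U₀ : GaugeField (F.P K) 0 (Matrix.specialUnitaryGroup (Fin 2) ℂ)}
  {𝒢 : NegSize (F.L : ℝ) (((F.L : ℝ)⁻¹) ^ (K - n)) (fun _ : Bond 3 (periodsT3 F K) => K - n) 3 (Matrix (Fin 2) (Fin 2) ℂ) →L[ℂ]
        Space115 (F.L : ℝ) (((F.L : ℝ)⁻¹) ^ (K - n)) (fun _ : Bond 3 (periodsT3 F K) => K - n) (fun _ : Bond 3 (periodsT3 F K) × Fin 3 => K - n)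
          (nabla115 (((F.L : ℝ)⁻¹) ^ (K - n)) (bgOfCfg F K U₀))}
  {W : Space115 (F.L : ℝ) (((F.L : ℝ)⁻¹) ^ (K - n)) (fun _ : Bond 3 (periodsT3 F K) => K - n) (fun _ : Bond 3 (periodsT3 F K) × Fin 3 => K - n)
          (nabla115 (((F.L : ℝ)⁻¹) ^ (K - n)) (bgOfCfg F K U₀)) →
        NegSize (F.L : ℝ) (((F.L : ℝ)⁻¹) ^ (K - n)) (fun _ : Bond 3 (periodsT3 F K) => K - n) 3 (Matrix (Fin 2) (Fin 2) ℂ)}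
  {H₁ : (PBond (F.P n) 0 → Matrix (Fin 2) (Fin 2) ℂ) →L[ℂ]
        Space115 (F.L : ℝ) (((F.L : ℝ)⁻¹) ^ (K - n)) (fun _ : Bond 3 (periodsT3 F K) => K - n) (fun _ : Bond 3 (periodsT3 F K) × Fin 3 => K - n)
          (nabla115 (((F.L : ℝ)⁻¹) ^ (K - n)) (bgOfCfg F K U₀))}
  {H : (PBond (F.P n) 0 → Matrix (Fin 2) (Fin 2) ℂ) →ₗ[ℂ] (PBond (F.P K) 0 → Matrix (Fin 2) (Fin 2) ℂ)}

/-- ★ **THE (CH5EL-twˢ) DISPLAY `hXtw` FROM THE REFINED DISPLAY `hXtw′` AND THE ROWS (102)-twS ∕ (129)-twS, AT SCALE, (21)-LETTER GENERIC** (generic ✓`hXtw_of_split_etaS`: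
chart parameter `A′ := iη·(ι A₁ + ι(H₁ Bsym))`, datum equation ✓`datum_of_split_etaS`, radius `η(ε₄ + ρ) ≤ ε`; the (21) conjunct `Lan X` passes through).
[cite: Balaban1985Variational, (43) p.285, (103) p.293, (112) p.294, Prop. 5 p.294, (19)–(21) p.281] -/
theorem hXtw_of_split_etaG (Lan : (PBond (F.P K) 0 → Matrix (Fin 2) (Fin 2) ℂ) → Prop) {ε₄ M C₂ ε ρ : ℝ}
    (h102 : ∀ f : NegSize (F.L : ℝ) (((F.L : ℝ)⁻¹) ^ (K - n)) (fun _ : Bond 3 (periodsT3 F K) => K - n) 3 (Matrix (Fin 2) (Fin 2) ℂ),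
      QTwS F n K h U₀ (fun b : PBond (F.P K) 0 => JetSup.equiv _ _ _ (𝒢 f) (bondEquiv F K b)) = 0)
    (h129 : ∀ B : PBond (F.P n) 0 → Matrix (Fin 2) (Fin 2) ℂ,
      QTwS F n K h U₀ (fun b : PBond (F.P K) 0 => JetSup.equiv _ _ _ (H₁ B) (bondEquiv F K b)) = fun c => (((eta F n K : ℝ) : ℂ))⁻¹ • B c)
    (hρ : ‖H₁ (fun c : PBond (F.P n) 0 =>
        (-Complex.I) • mlog (((V c : Matrix.specialUnitaryGroup (Fin 2) ℂ) : Matrix (Fin 2) (Fin 2) ℂ)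
          * star ((descendTo F ℰp n K h U₀ c : Matrix.specialUnitaryGroup (Fin 2) ℂ) : Matrix (Fin 2) (Fin 2) ℂ)))‖ ≤ ρ)
    (hε : eta F n K * (ε₄ + ρ) ≤ ε)
    -- the refined display: (112) ∘ Prop. 5 ∘ (123)–(140) ∘ E–L at `A′ := iη·(ι A₁ + ι(H₁ Bsym))`
    (hXtw' : ∀ A₁ : Space115 (F.L : ℝ) (((F.L : ℝ)⁻¹) ^ (K - n)) (fun _ : Bond 3 (periodsT3 F K) => K - n) (fun _ : Bond 3 (periodsT3 F K) × Fin 3 => K - n)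
            (nabla115 (((F.L : ℝ)⁻¹) ^ (K - n)) (bgOfCfg F K U₀)),
      ‖A₁‖ < ε₄ → A₁ + 𝒢 (Jcur (bgOfCfg F K U₀)) + 𝒢 (W (A₁ + H₁ (fun c : PBond (F.P n) 0 =>
        (-Complex.I) • mlog (((V c : Matrix.specialUnitaryGroup (Fin 2) ℂ) : Matrix (Fin 2) (Fin 2) ℂ)
          * star ((descendTo F ℰp n K h U₀ c : Matrix.specialUnitaryGroup (Fin 2) ℂ) : Matrix (Fin 2) (Fin 2) ℂ))))) = 0 →
        ∃ X : PBond (F.P K) 0 → Matrix (Fin 2) (Fin 2) ℂ,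
          (∀ b : PBond (F.P K) 0, (X b).IsHermitian ∧ Matrix.trace (X b) = 0) ∧
          (((eta F n K : ℝ) : ℂ) * Complex.I) • ((fun b : PBond (F.P K) 0 => JetSup.equiv _ _ _ A₁ (bondEquiv F K b))
              + (fun b : PBond (F.P K) 0 => JetSup.equiv _ _ _ (H₁ (fun c : PBond (F.P n) 0 =>
        (-Complex.I) • mlog (((V c : Matrix.specialUnitaryGroup (Fin 2) ℂ) : Matrix (Fin 2) (Fin 2) ℂ)
          * star ((descendTo F ℰp n K h U₀ c : Matrix.specialUnitaryGroup (Fin 2) ℂ) : Matrix (Fin 2) (Fin 2) ℂ)))) (bondEquiv F K b)))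
            - H (Dfix (CmapTwS F n K h U₀) H C₂
              ((((eta F n K : ℝ) : ℂ) * Complex.I) • ((fun b : PBond (F.P K) 0 => JetSup.equiv _ _ _ A₁ (bondEquiv F K b))
              + (fun b : PBond (F.P K) 0 => JetSup.equiv _ _ _ (H₁ (fun c : PBond (F.P n) 0 =>
        (-Complex.I) • mlog (((V c : Matrix.specialUnitaryGroup (Fin 2) ℂ) : Matrix (Fin 2) (Fin 2) ℂ)
          * star ((descendTo F ℰp n K h U₀ c : Matrix.specialUnitaryGroup (Fin 2) ℂ) : Matrix (Fin 2) (Fin 2) ℂ)))) (bondEquiv F K b)))))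
            = (fun b => Complex.I • X b) ∧
          nMax19 F n K U₀ X ≤ M * (‖A₁‖ + ‖H₁ (fun c : PBond (F.P n) 0 =>
        (-Complex.I) • mlog (((V c : Matrix.specialUnitaryGroup (Fin 2) ℂ) : Matrix (Fin 2) (Fin 2) ℂ)
          * star ((descendTo F ℰp n K h U₀ c : Matrix.specialUnitaryGroup (Fin 2) ℂ) : Matrix (Fin 2) (Fin 2) ℂ)))‖) ∧
          Lan X ∧
          (∀ u : GaugeTransf (F.P K) 0 (Matrix.specialUnitaryGroup (Fin 2) ℂ), NormS F n K h U₀ X (expHermField X) u →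
            GaugeField.gaugeAct u (emb15 U₀ (expHermField X)) ∈ fibre F ℰp n K h V →
            ∀ γ : ℝ → GaugeField (F.P K) 0 (Matrix.specialUnitaryGroup (Fin 2) ℂ), γ 0 = GaugeField.gaugeAct u (emb15 U₀ (expHermField X)) →
              (∀ t, γ t ∈ fibre F ℰp n K h V) →
              (∀ b, DifferentiableAt ℝ (fun t => ((γ t b : Matrix.specialUnitaryGroup (Fin 2) ℂ) : Matrix (Fin 2) (Fin 2) ℂ)) 0) →
                deriv (fun t => wilsonAction4 (γ t)) 0 = 0)) :
    ∀ A₁ : Space115 (F.L : ℝ) (((F.L : ℝ)⁻¹) ^ (K - n)) (fun _ : Bond 3 (periodsT3 F K) => K - n) (fun _ : Bond 3 (periodsT3 F K) × Fin 3 => K - n)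
          (nabla115 (((F.L : ℝ)⁻¹) ^ (K - n)) (bgOfCfg F K U₀)),
      ‖A₁‖ < ε₄ → A₁ + 𝒢 (Jcur (bgOfCfg F K U₀)) + 𝒢 (W (A₁ + H₁ (fun c : PBond (F.P n) 0 =>
        (-Complex.I) • mlog (((V c : Matrix.specialUnitaryGroup (Fin 2) ℂ) : Matrix (Fin 2) (Fin 2) ℂ)
          * star ((descendTo F ℰp n K h U₀ c : Matrix.specialUnitaryGroup (Fin 2) ℂ) : Matrix (Fin 2) (Fin 2) ℂ))))) = 0 →
        ∃ (A' : PBond (F.P K) 0 → Matrix (Fin 2) (Fin 2) ℂ) (X : PBond (F.P K) 0 → Matrix (Fin 2) (Fin 2) ℂ),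
          ‖A'‖ < ε ∧
          QTwS F n K h U₀ A' = (fun c => mlog (((unitsField (toUField V) c * (unitsField (toUField (descendTo F ℰp n K h U₀)) c)⁻¹ :
              (Matrix (Fin 2) (Fin 2) ℂ)ˣ) : Matrix (Fin 2) (Fin 2) ℂ))) ∧
          (∀ b : PBond (F.P K) 0, (X b).IsHermitian ∧ Matrix.trace (X b) = 0) ∧
          A' - H (Dfix (CmapTwS F n K h U₀) H C₂ A') = (fun b => Complex.I • X b) ∧
          nMax19 F n K U₀ X ≤ M * (‖A₁‖ + ‖H₁ (fun c : PBond (F.P n) 0 =>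
        (-Complex.I) • mlog (((V c : Matrix.specialUnitaryGroup (Fin 2) ℂ) : Matrix (Fin 2) (Fin 2) ℂ)
          * star ((descendTo F ℰp n K h U₀ c : Matrix.specialUnitaryGroup (Fin 2) ℂ) : Matrix (Fin 2) (Fin 2) ℂ)))‖) ∧ Lan X ∧
          (∀ u : GaugeTransf (F.P K) 0 (Matrix.specialUnitaryGroup (Fin 2) ℂ), NormS F n K h U₀ X (expHermField X) u →
            GaugeField.gaugeAct u (emb15 U₀ (expHermField X)) ∈ fibre F ℰp n K h V →
            ∀ γ : ℝ → GaugeField (F.P K) 0 (Matrix.specialUnitaryGroup (Fin 2) ℂ), γ 0 = GaugeField.gaugeAct u (emb15 U₀ (expHermField X)) →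
              (∀ t, γ t ∈ fibre F ℰp n K h V) →
              (∀ b, DifferentiableAt ℝ (fun t => ((γ t b : Matrix.specialUnitaryGroup (Fin 2) ℂ) : Matrix (Fin 2) (Fin 2) ℂ)) 0) →
                deriv (fun t => wilsonAction4 (γ t)) 0 = 0) := by
  intro A₁ hA₁ h111
  obtain ⟨X, hX, hAX, hsize, h21, hEL⟩ := hXtw' A₁ hA₁ h111
  refine ⟨_, X, ?_, datum_of_split_etaS F h h102 h129 A₁ h111, hX, hAX, hsize, h21, hEL⟩
  -- `‖A′‖ = η·‖ι A₁ + ι(H₁B)‖ ≤ η(‖A₁‖₍₁₁₅₎ + ‖H₁B‖₍₁₁₅₎) < η(ε₄ + ρ) ≤ ε`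
  have hη0 : 0 < eta F n K := eta_pos F n K
  have hnI : ‖(((eta F n K : ℝ) : ℂ)) * Complex.I‖ = eta F n K := by
    rw [norm_mul, Complex.norm_I, mul_one, Complex.norm_real, Real.norm_of_nonneg hη0.le]
  rw [norm_smul, hnI]
  calc eta F n K * ‖(fun b : PBond (F.P K) 0 => JetSup.equiv _ _ _ A₁ (bondEquiv F K b))
          + (fun b : PBond (F.P K) 0 => JetSup.equiv _ _ _ (H₁ (fun c : PBond (F.P n) 0 =>
        (-Complex.I) • mlog (((V c : Matrix.specialUnitaryGroup (Fin 2) ℂ) : Matrix (Fin 2) (Fin 2) ℂ)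
          * star ((descendTo F ℰp n K h U₀ c : Matrix.specialUnitaryGroup (Fin 2) ℂ) : Matrix (Fin 2) (Fin 2) ℂ)))) (bondEquiv F K b))‖
      ≤ eta F n K * (‖A₁‖ + ‖H₁ (fun c : PBond (F.P n) 0 =>
        (-Complex.I) • mlog (((V c : Matrix.specialUnitaryGroup (Fin 2) ℂ) : Matrix (Fin 2) (Fin 2) ℂ)
          * star ((descendTo F ℰp n K h U₀ c : Matrix.specialUnitaryGroup (Fin 2) ℂ) : Matrix (Fin 2) (Fin 2) ℂ)))‖) := by
        refine mul_le_mul_of_nonneg_left ((norm_add_le _ _).trans (add_le_add (norm_jetRead_le F _) (norm_jetRead_le F _))) hη0.le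
    _ < eta F n K * (ε₄ + ρ) := mul_lt_mul_of_pos_left (add_lt_add_of_lt_of_le hA₁ hρ) hη0
    _ ≤ ε := hε

end SplitEtaG

/-! ## §4 CHART-112ˢ at one member, (21)-letter generic -/

/-- ★★ **CHART-112ˢ (five conjuncts) FROM THE PIECES OF THE CHART OF RECORD, (21)-LETTER GENERIC** (generic ✓`hChart_of_piecesTwS`: Prop. 3 `Chart47T3twS … U₀ H` + `QTwS∘H = id`,
the `NormS` witness row, the `dbarTwS` window, the displayed remainder `hXtw` with (21) conjunct `Lan X`; conclusion: `X` Hermitian-traceless, (19)-size, (20)ˢ `AvgCondPrintS`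
(✓`fibreClauseS_of_chart47twS` ∘ witness ∘ ✓`regPr_emb15_of_in19`), `Lan X`, E–L). [cite: Balaban1985Variational, (112) p.294, Prop. 3 p.289, (47)–(49) p.285, (19)–(21) p.281; Balaban1985RegularSpaces, (1.28)–(1.31) pp.81–82, Prop. 7 p.98; Balaban1985Averaging, (87) p.31] -/
theorem hChart_of_piecesTwG [Fact (0 < (F.L : ℝ))] [Fact (0 < ((F.L : ℝ)⁻¹) ^ (K - n))] (Lan : (PBond (F.P K) 0 → Matrix (Fin 2) (Fin 2) ℂ) → Prop) {ε₀ b ε₄ M e C₂ ε : ℝ}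
    (hε₀ : 0 < ε₀) (hε₀16 : ε₀ ≤ 1 / 16) (he0 : 0 < e) (he20 : e ≤ 1 / 20) (hb : b ≤ 1)
    (hw137 : 10 ^ 7 * (F.L : ℝ) ^ 3 * (178 * (ε₀ + e)) ≤ 1)
    {V : GaugeField (F.P n) 0 (Matrix.specialUnitaryGroup (Fin 2) ℂ)} {U₀ : GaugeField (F.P K) 0 (Matrix.specialUnitaryGroup (Fin 2) ℂ)}
    (hreg : RegPr F n K ε₀ U₀) (hclose : CloseAvg F n K h b V U₀)
    {𝒢 : NegSize (F.L : ℝ) (((F.L : ℝ)⁻¹) ^ (K - n)) (fun _ : Bond 3 (periodsT3 F K) => K - n) 3 (Matrix (Fin 2) (Fin 2) ℂ) →L[ℂ]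
          Space115 (F.L : ℝ) (((F.L : ℝ)⁻¹) ^ (K - n)) (fun _ : Bond 3 (periodsT3 F K) => K - n) (fun _ : Bond 3 (periodsT3 F K) × Fin 3 => K - n)
            (nabla115 (((F.L : ℝ)⁻¹) ^ (K - n)) (bgOfCfg F K U₀))}
    {W : Space115 (F.L : ℝ) (((F.L : ℝ)⁻¹) ^ (K - n)) (fun _ : Bond 3 (periodsT3 F K) => K - n) (fun _ : Bond 3 (periodsT3 F K) × Fin 3 => K - n)
            (nabla115 (((F.L : ℝ)⁻¹) ^ (K - n)) (bgOfCfg F K U₀)) →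
          NegSize (F.L : ℝ) (((F.L : ℝ)⁻¹) ^ (K - n)) (fun _ : Bond 3 (periodsT3 F K) => K - n) 3 (Matrix (Fin 2) (Fin 2) ℂ)}
    {H₁ : (PBond (F.P n) 0 → Matrix (Fin 2) (Fin 2) ℂ) →L[ℂ]
          Space115 (F.L : ℝ) (((F.L : ℝ)⁻¹) ^ (K - n)) (fun _ : Bond 3 (periodsT3 F K) => K - n) (fun _ : Bond 3 (periodsT3 F K) × Fin 3 => K - n)
            (nabla115 (((F.L : ℝ)⁻¹) ^ (K - n)) (bgOfCfg F K U₀))}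
    {B : PBond (F.P n) 0 → Matrix (Fin 2) (Fin 2) ℂ}
    {H : (PBond (F.P n) 0 → Matrix (Fin 2) (Fin 2) ℂ) →ₗ[ℂ] (PBond (F.P K) 0 → Matrix (Fin 2) (Fin 2) ℂ)}
    -- Prop. 3 for the chart of record (symmetric centre-anchored frames) with (45)–(46)-twˢ (DISPLAYED in the knit)
    (h47 : Chart47T3twS F n K h C₂ ε U₀ H) (hQH : ∀ Y, QTwS F n K h U₀ (H Y) = Y)
    -- CHART-ΣS WITNESS: the axial gauge transformation with the prescribed symmetric top-centre data (DISPLAYED; ★w5-20520 g4's row)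
    (hWit : ∀ X : PBond (F.P K) 0 → Matrix (Fin 2) (Fin 2) ℂ, (∀ b : PBond (F.P K) 0, (X b).IsHermitian ∧ Matrix.trace (X b) = 0) → nMax19 F n K U₀ X < e →
      ∃ u : GaugeTransf (F.P K) 0 (Matrix.specialUnitaryGroup (Fin 2) ℂ), NormS F n K h U₀ X (expHermField X) u)
    -- the `log` window of the symmetric-frame average at chart points of (19)-size `< e` (DISPLAYED in the knit; ✓`Prop7DbarTwSymWindow`)
    (hwin : ∀ X : PBond (F.P K) 0 → Matrix (Fin 2) (Fin 2) ℂ, (∀ b : PBond (F.P K) 0, (X b).IsHermitian ∧ Matrix.trace (X b) = 0) → nMax19 F n K U₀ X < e →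
      ∀ c : PBond (F.P n) 0, ‖((dbarTwS F n K h U₀ (fun b => Complex.I • X b) c : (Matrix (Fin 2) (Fin 2) ℂ)ˣ) : Matrix (Fin 2) (Fin 2) ℂ) - 1‖ < 1)
    -- (CH5EL-twˢ) the displayed remainder: (112) ∘ Prop. 5 ∘ (123)–(140) ∘ (102)–(103) ∘ E–L in the letters of record
    (hXtw : ∀ A₁ : Space115 (F.L : ℝ) (((F.L : ℝ)⁻¹) ^ (K - n)) (fun _ : Bond 3 (periodsT3 F K) => K - n) (fun _ : Bond 3 (periodsT3 F K) × Fin 3 => K - n)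
            (nabla115 (((F.L : ℝ)⁻¹) ^ (K - n)) (bgOfCfg F K U₀)),
      ‖A₁‖ < ε₄ → A₁ + 𝒢 (Jcur (bgOfCfg F K U₀)) + 𝒢 (W (A₁ + H₁ B)) = 0 →
        ∃ (A' : PBond (F.P K) 0 → Matrix (Fin 2) (Fin 2) ℂ) (X : PBond (F.P K) 0 → Matrix (Fin 2) (Fin 2) ℂ),
          ‖A'‖ < ε ∧
          QTwS F n K h U₀ A' = (fun c => mlog (((unitsField (toUField V) c * (unitsField (toUField (descendTo F ℰp n K h U₀)) c)⁻¹ :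
              (Matrix (Fin 2) (Fin 2) ℂ)ˣ) : Matrix (Fin 2) (Fin 2) ℂ))) ∧
          (∀ b : PBond (F.P K) 0, (X b).IsHermitian ∧ Matrix.trace (X b) = 0) ∧
          A' - H (Dfix (CmapTwS F n K h U₀) H C₂ A') = (fun b => Complex.I • X b) ∧
          nMax19 F n K U₀ X ≤ M * (‖A₁‖ + ‖H₁ B‖) ∧ Lan X ∧
          (∀ u : GaugeTransf (F.P K) 0 (Matrix.specialUnitaryGroup (Fin 2) ℂ), NormS F n K h U₀ X (expHermField X) u →
            GaugeField.gaugeAct u (emb15 U₀ (expHermField X)) ∈ fibre F ℰp n K h V →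
            ∀ γ : ℝ → GaugeField (F.P K) 0 (Matrix.specialUnitaryGroup (Fin 2) ℂ), γ 0 = GaugeField.gaugeAct u (emb15 U₀ (expHermField X)) →
              (∀ t, γ t ∈ fibre F ℰp n K h V) →
              (∀ b, DifferentiableAt ℝ (fun t => ((γ t b : Matrix.specialUnitaryGroup (Fin 2) ℂ) : Matrix (Fin 2) (Fin 2) ℂ)) 0) →
                deriv (fun t => wilsonAction4 (γ t)) 0 = 0))
    (hM : 0 ≤ M) (hMe : M * (ε₄ + ‖H₁ B‖) < e) :
    ∀ A₁ : Space115 (F.L : ℝ) (((F.L : ℝ)⁻¹) ^ (K - n)) (fun _ : Bond 3 (periodsT3 F K) => K - n) (fun _ : Bond 3 (periodsT3 F K) × Fin 3 => K - n)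
          (nabla115 (((F.L : ℝ)⁻¹) ^ (K - n)) (bgOfCfg F K U₀)),
      ‖A₁‖ < ε₄ → A₁ + 𝒢 (Jcur (bgOfCfg F K U₀)) + 𝒢 (W (A₁ + H₁ B)) = 0 →
        ∃ X : PBond (F.P K) 0 → Matrix (Fin 2) (Fin 2) ℂ,
          (∀ b : PBond (F.P K) 0, (X b).IsHermitian ∧ Matrix.trace (X b) = 0) ∧
          nMax19 F n K U₀ X ≤ M * (‖A₁‖ + ‖H₁ B‖) ∧ AvgCondPrintS F n K h V U₀ X ∧ Lan X ∧
          (∀ u : GaugeTransf (F.P K) 0 (Matrix.specialUnitaryGroup (Fin 2) ℂ), NormS F n K h U₀ X (expHermField X) u →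
            GaugeField.gaugeAct u (emb15 U₀ (expHermField X)) ∈ fibre F ℰp n K h V →
            ∀ γ : ℝ → GaugeField (F.P K) 0 (Matrix.specialUnitaryGroup (Fin 2) ℂ), γ 0 = GaugeField.gaugeAct u (emb15 U₀ (expHermField X)) →
              (∀ t, γ t ∈ fibre F ℰp n K h V) →
              (∀ b, DifferentiableAt ℝ (fun t => ((γ t b : Matrix.specialUnitaryGroup (Fin 2) ℂ) : Matrix (Fin 2) (Fin 2) ℂ)) 0) →
                deriv (fun t => wilsonAction4 (γ t)) 0 = 0) := by
  intro A₁ hA₁ h111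
  obtain ⟨A', X, hA', hQA', hX, hAX, hsize, h21, hEL⟩ := hXtw A₁ hA₁ h111
  refine ⟨X, hX, hsize, ?_, h21, hEL⟩
  -- the (19)-size of `X` is below the witness ∕ window radius `e`
  have hlt : nMax19 F n K U₀ X < e := by
    have h1 : M * (‖A₁‖ + ‖H₁ B‖) ≤ M * (ε₄ + ‖H₁ B‖) := mul_le_mul_of_nonneg_left (by linarith) hM
    exact lt_of_le_of_lt (hsize.trans h1) hMe
  -- [Balaban1985RegularSpaces] Prop. 7: the chart point `e^{iX}U₀` is printed-regular of radius `178(ε₀ + e)`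
  have hL0 : (0 : ℝ) < (F.L : ℝ) := Fact.out
  have hL1 : (1 : ℝ) ≤ (F.L : ℝ) := by have := F.hL.2; exact_mod_cast (by omega : 1 ≤ F.L)
  have hL3 : (1 : ℝ) ≤ (F.L : ℝ) ^ 3 := one_le_pow₀ hL1
  have hε₂ : ε₀ + e ≤ 1 / 4 := by linarith
  have hε₂0 : 0 < ε₀ + e := by linarith
  have h19 : In19 F n K (ε₀ + e) U₀ (expHermField X) X := in19_expHermField_of_nMax19_lt hX (hlt.trans_le (by linarith))
  have hU₁ : RegPr F n K (178 * (ε₀ + e)) (emb15 U₀ (expHermField X)) := regPr_emb15_of_in19 F n K hε₂ (by linarith) hreg h19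
  have hε₁0 : 0 < 178 * (ε₀ + e) := by positivity
  -- the background's window `10⁷L³ε₀ ≤ 1` from `10⁷L³·178(ε₀ + e) ≤ 1`
  have hε₀' : 10 ^ 7 * (F.L : ℝ) ^ 3 * ε₀ ≤ 1 := by
    have h1 : ε₀ ≤ 178 * (ε₀ + e) := by nlinarith
    have h2 : (0 : ℝ) ≤ 10 ^ 7 * (F.L : ℝ) ^ 3 := by positivity
    exact (mul_le_mul_of_nonneg_left h1 h2).trans hw137
  -- (20)ˢ: the `NormS` witness + the fibre clause of the S chart as a THEOREM (✓`fibreClauseS_of_chart47twS`)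
  have hfib := fibreClauseS_of_chart47twS F h hε₀ hε₀' hε₁0 hw137 hreg h47 hQH V A' hA' hQA' hX hAX hU₁ (hwin X hX hlt)
    (norm_datum_sub_one_lt_of_closeAvg F h hb V U₀ hclose)
  obtain ⟨u, hu⟩ := hWit X hX hlt
  intro U₁ hU₁eq
  have hU₁X : U₁ = expHermField X := by
    funext b'
    apply Subtype.ext
    rw [hU₁eq b', expHermField_apply, coe_expHerm (hX b')]
  subst hU₁X
  exact ⟨u, hu, hfib u hu.2⟩

end Summit.QuantumFields.YangMills.Theorems.Prop7ChartPiecesTwG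

end
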